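import Summits.AtomisticToContinuum.Crystallization.Theorems.ChargedEnergyGapBallLedger

/-!
# `PricedLinkCensus.ChargedEnergyGap` (stmt-AtomisticToContinuum-14231) — the TRANSMISSION CUT of the incoherent cores: MONOLITHIC vs WALLED
# (decomp-a2c lens 3, generation 47, part J; over part I-B `ChargedEnergyGapBallLedger`)

The engine «of a known kind» (geometric rigidity + incompatibility, critic rows 894 / 901) prices an incoherent core through the
elastic field its holonomy forces on the CHARTED matter around it: the misfit between the frame-fitting charge-free points and the
misfit witness (`exists_charted_misfit`, part H-A) is TRANSMITTED along chains of charted sites, each chart slightly strained, and the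
strain energy of the halo is the price.  That mechanism has a typed precondition: the charge-free points within reach must be joined
THROUGH CHARTED MATTER.  When an UNCHARTED WALL separates them — a high-angle grain boundary, an incoherent twin or phase interface,
the boundary of a misoriented inclusion, a translation-domain wall (incoherent under the re-pointed window of part H-A) — the two
sides are perfect crystals, the charted strain is ZERO, and the whole price sits in the wall's core: an AREA LAW for a frustrated film
between two misoriented crystals, which is `TetrahedralFrustration`-ringed and NOT of the known kind (MEMO §3, finding F3).

§1 `ChartedChain θ s ϱ' Q p a b` (a chain `a = c₀, …, c_{n+1} = b` of step `≤ s` whose intermediate points are `θ`-charted points of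
   `Q` inside `B(p, ϱ')`) and
   `Monolithic θ s ϱ' L' Q p` (every two charge-free points of `Q` within `L'` of `p` are so joined); TWO TYPED ENDS: `s ≥ 2L'` ⇒
   everything is monolithic (one step); `s < 0` ⇒ nothing with crystal within `L'` is (in particular no incoherent core).
§2 THE CUT (exact, every parameter): incoherent = MONOLITHIC + WALLED cores (`motifCoreIncoherent_eq_monolithic_add_walled`),
   ★ `NCP ⟺ MCP ∧ WCP` (`incoherentCorePricing_iff_monolithic_walled`), ★ `BALL ⟺ BALL|monolithic ∧ BALL|walled`
   (`coreBallPricing_iff_monolithic_walled`, from part I-B's ∀-split); the two ends on the pieces.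
RECORD LITERALS `(s, ϱ') = (6/5, 80)`: the chain step is the chart radius `R = 6/5` (a charted site's first shell lies within
`(6/5)·nn`), the chain region is the coherence ball doubled, `ϱ' = 2L' = 80` (a chain may leave the reach ball to go round the edge of a
FINITE wall — a terminated low-angle wall is strain-carried at long range and is correctly sorted monolithic; a closed or bi-infinite
wall cannot be circumvented).

⚠ GENERATION 48 ERRATUM (memo `g48/MEMO.md` §1).  BALL|monolithic and BALL|walled inherit the rim-flower refutation of BALL (part I-B,
erratum there): REFUTED AS TYPED; the ∀-split, the dial ends and the count pricings MCP / WCP are unaffected theorems.  Generation-47 tags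
below kept for the record.

TAGS (generation 47; at the record, beneath BALL of part I-B).
BALL|monolithic `CoreBallPricingOn … IsMonolithicAt` · WEAKER than BALL (proved, ∀-split) · TRUE-leaning · IDEA-NEEDED OF THE KNOWN KIND —
  now with its precondition typed: chain-transmitted misfit ⇒ charted strain content `Σ_chain D ≥ (δ/(C n))²·…` (Cauchy–Schwarz along the
  chain; the P-side drift lemmas `LabelDriftBound` are the one-step estimate) ⇒ halo energy by harmonic coercivity; plus a CORE FLOOR
  (the uncharted core rows are not over-bound in aggregate against their own halo — the smooth ball contains both, so no interface term
  is ever split; MEMO §3 F4) · INSTRUMENTABLE (L3-BALL (a): dislocations, loops, low-angle walls, locks, SFTs).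
BALL|walled `CoreBallPricingOn … (¬ IsMonolithicAt)` · WEAKER than BALL (proved) · UNDECIDED · ★ DECLARED SUB-RESIDUAL #3 of the G-side:
  «a film of uncharted matter separating two crystal grains inside a ball of radius `80` has smooth-ball excess `≥ κ₀` per core site» —
  an AREA LAW for frustrated films; BARRIER-ringed (`TetrahedralFrustration`: grain-boundary cores built from tetrahedral / pentagonal-
  bipyramidal units are locally over-bound; the bet is that a FILM, unlike a bulk region, cannot hide its frustration: it must match two
  incompatible crystal half-spaces) · INSTRUMENTABLE (L3-BALL (b): symmetric / asymmetric tilt and twist boundaries Σ3–Σ51, incoherent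
  twin, translation-domain walls `v = ½⟨110⟩/2`, misoriented spherical inclusions d = 20–60).
MCP / WCP (the debit-free count pricings of the two halves) · WEAKER than NCP (proved) · bookkeeping for the census.
All `[this work]`.
-/

noncomputable section

open scoped Classical
open Literature.MathematicalPhysics.StatisticalMechanics
open Literature.Geometry.DiscreteGeometry
open Summit.AtomisticToContinuum.Crystallization.Theses.PricedLinkCensus
open Summit.AtomisticToContinuum.Crystallization.Theorems.ChargedEnergyGapNegative

namespace Summit.AtomisticToContinuum.Crystallization.Theorems.ChargedEnergyGapChartDial

/-! ## §1 Charted chains and monolithic surroundings -/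

/-- A **CHARTED CHAIN** of step `s` inside `B(p, ϱ')` from `a` to `b`: points `a = c₀, c₁, …, c_{n+1} = b` with every INTERMEDIATE
`cᵢ` a `θ`-charted point of `Q` within `ϱ'` of `p`, and consecutive distances at most `s` (at least one step, even when `a = b`). -/
def ChartedChain (θ s ϱ' : ℝ) (Q : PeriodicConfiguration 3) (p a b : E3) : Prop :=
  ∃ (n : ℕ) (c : Fin (n + 2) → E3), c 0 = a ∧ c (Fin.last (n + 1)) = b ∧
    (∀ i : Fin (n + 2), i ≠ 0 → i ≠ Fin.last (n + 1) → ∃ hq : c i ∈ Q.points, ChartedAt θ Q ⟨c i, hq⟩ ∧ dist p (c i) ≤ ϱ') ∧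
      ∀ i : Fin (n + 1), dist (c i.castSucc) (c i.succ) ≤ s

/-- **MONOLITHIC surroundings**: every two charge-free points of `Q` within `L'` of `p` are joined by a charted chain of step `s` inside
`B(p, ϱ')` — the misfit of an incoherent core at `p` is then transmitted through charted matter.  Its negation: WALLED. -/
def Monolithic (θ s ϱ' L' : ℝ) (Q : PeriodicConfiguration 3) (p : E3) : Prop :=
  ∀ (a : E3) (ha : a ∈ Q.points) (b : E3) (hb : b ∈ Q.points),
    IsChargeFree (1 / 100) (Subtype.val : Q.points → E3) ⟨a, ha⟩ → IsChargeFree (1 / 100) (Subtype.val : Q.points → E3) ⟨b, hb⟩ →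
      dist p a ≤ L' → dist p b ≤ L' → ChartedChain θ s ϱ' Q p a b

/-- Chains are monotone in the step and the region. -/
theorem ChartedChain.mono {θ s s' ϱ' ϱ'' : ℝ} (hs : s ≤ s') (hϱ : ϱ' ≤ ϱ'') {Q : PeriodicConfiguration 3} {p a b : E3}
    (h : ChartedChain θ s ϱ' Q p a b) : ChartedChain θ s' ϱ'' Q p a b := by
  obtain ⟨n, c, ha, hb, hmid, hstep⟩ := h
  exact ⟨n, c, ha, hb, fun i hi0 hi1 => let ⟨hq, hch, hd⟩ := hmid i hi0 hi1; ⟨hq, hch, hd.trans hϱ⟩,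
    fun i => (hstep i).trans hs⟩

/-- Monolithicity is monotone in the slack `s` and the radius. -/
theorem Monolithic.mono {θ s s' ϱ' ϱ'' L' : ℝ} (hs : s ≤ s') (hϱ : ϱ' ≤ ϱ'') {Q : PeriodicConfiguration 3} {p : E3}
    (h : Monolithic θ s ϱ' L' Q p) : Monolithic θ s' ϱ'' L' Q p :=
  fun a ha b hb hca hcb hda hdb => (h a ha b hb hca hcb hda hdb).mono hs hϱ

/-- ★ Typed end `s ≥ 2L'`: EVERYTHING is monolithic (the one-step chain `a, b`). -/
theorem monolithic_of_two_mul_le {θ s ϱ' L' : ℝ} (hs : 2 * L' ≤ s) (Q : PeriodicConfiguration 3) (p : E3) :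
    Monolithic θ s ϱ' L' Q p := by
  intro a _ b _ _ _ hda hdb
  have hab : dist a b ≤ s := by
    calc dist a b ≤ dist a p + dist p b := dist_triangle a p b
      _ = dist p a + dist p b := by rw [dist_comm a p]
      _ ≤ s := by linarith
  refine ⟨0, ![a, b], rfl, rfl, fun i hi0 hi1 => ?_, fun i => ?_⟩
  · exact (hi1 (Fin.eq_last_of_not_lt fun h => hi0 (Fin.ext (by simpa using h)))).elim
  · rw [Fin.eq_zero i]; simpa using hab

/-- A chain of negative step joins nothing (not even a point to itself: a chain has at least one step). -/
theorem not_chartedChain_of_neg {θ s ϱ' : ℝ} (hs : s < 0) (Q : PeriodicConfiguration 3) (p a b : E3) :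
    ¬ ChartedChain θ s ϱ' Q p a b := by
  rintro ⟨n, c, -, -, -, hstep⟩
  exact absurd (dist_nonneg.trans (hstep 0)) (not_le.2 hs)

/-- ★ Typed end `s < 0`: a point with crystal within `L'` is NOT monolithic — in particular (part H-A
`crystalWithin_of_not_coherentWithin`) every incoherent core is walled. -/
theorem not_monolithic_of_neg {θ s ϱ' L' : ℝ} (hs : s < 0) {Q : PeriodicConfiguration 3} {p : E3} (hp : CrystalWithin L' Q p) :
    ¬ Monolithic θ s ϱ' L' Q p := by
  obtain ⟨q, hq, hc, hd⟩ := hp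
  exact fun h => not_chartedChain_of_neg hs Q p q q (h q hq q hq hc hc hd hd)

/-- With negative slack no incoherent site is monolithic. -/
theorem not_monolithic_of_neg_of_not_coherentWithin {θ s ϱ' δ L' : ℝ} (hs : s < 0) {Q : PeriodicConfiguration 3} {p : E3}
    (hp : ¬ CoherentWithin δ L' Q p) : ¬ Monolithic θ s ϱ' L' Q p :=
  not_monolithic_of_neg hs (crystalWithin_of_not_coherentWithin hp)

/-! ## §2 The cut of the incoherent cores and of their pricings -/

section Cut

variable (θ ε R r η L δ L' s ϱ' ϱ c₁ : ℝ)

/-- The cut predicate on motif sites (read at the site, coherence reach `L'`). -/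
def IsMonolithicAt (Q : PeriodicConfiguration 3) (x : Q.motif) : Prop :=
  Monolithic θ s ϱ' L' Q (x : E3)

/-- Number of MONOLITHIC incoherent cores (strain-carried holonomy: dislocations, loops, low-angle walls, locks, SFTs). -/
def motifCoreMonolithic (Q : PeriodicConfiguration 3) : ℕ :=
  Nat.card {x : Q.motif // IsCore θ ε R r η L δ L' Q x ∧ IsMonolithicAt θ L' s ϱ' Q x}

/-- Number of WALLED incoherent cores (wall-carried holonomy: high-angle grain boundaries, incoherent interfaces, misoriented
inclusions, translation-domain walls). -/
def motifCoreWalled (Q : PeriodicConfiguration 3) : ℕ :=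
  Nat.card {x : Q.motif // IsCore θ ε R r η L δ L' Q x ∧ ¬ IsMonolithicAt θ L' s ϱ' Q x}

/-- ★ incoherent = monolithic + walled, every parameter. -/
theorem motifCoreIncoherent_eq_monolithic_add_walled (Q : PeriodicConfiguration 3) :
    motifCoreIncoherent θ ε R r η L δ L' Q = motifCoreMonolithic θ ε R r η L δ L' s ϱ' Q + motifCoreWalled θ ε R r η L δ L' s ϱ' Q := by
  rw [motifCoreIncoherent_eq_card_isCore,
    natCard_subtype_split (fun x : Q.motif => IsCore θ ε R r η L δ L' Q x) (fun x => IsMonolithicAt θ L' s ϱ' Q x), add_comm]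
  rfl

/-- The monolithic cores are among the incoherent cores. -/
theorem motifCoreMonolithic_le (Q : PeriodicConfiguration 3) :
    motifCoreMonolithic θ ε R r η L δ L' s ϱ' Q ≤ motifCoreIncoherent θ ε R r η L δ L' Q := by
  rw [motifCoreIncoherent_eq_monolithic_add_walled θ ε R r η L δ L' s ϱ' Q]; exact Nat.le_add_right _ _

/-- The walled cores are among the incoherent cores. -/
theorem motifCoreWalled_le (Q : PeriodicConfiguration 3) :
    motifCoreWalled θ ε R r η L δ L' s ϱ' Q ≤ motifCoreIncoherent θ ε R r η L δ L' Q := by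
  rw [motifCoreIncoherent_eq_monolithic_add_walled θ ε R r η L δ L' s ϱ' Q]; exact Nat.le_add_left _ _

/-- piece MCP · WEAKER than NCP (proved) · **MONOLITHIC CORE PRICING** (debit-free count pricing of the strain-carried half). -/
def MonolithicCorePricing : Prop :=
  SpeciesPricing (motifCoreMonolithic θ ε R r η L δ L' s ϱ')

/-- piece WCP · WEAKER than NCP (proved) · **WALLED CORE PRICING** (debit-free count pricing of the wall-carried half). -/
def WalledCorePricing : Prop :=
  SpeciesPricing (motifCoreWalled θ ε R r η L δ L' s ϱ')

/-- ★ **EXACT**: `NCP ⟺ MCP ∧ WCP`, every parameter. -/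
theorem incoherentCorePricing_iff_monolithic_walled :
    IncoherentCorePricing θ ε R r η L δ L' ↔
      MonolithicCorePricing θ ε R r η L δ L' s ϱ' ∧ WalledCorePricing θ ε R r η L δ L' s ϱ' := by
  rw [incoherentCorePricing_iff_speciesPricing,
    speciesPricing_congr (c' := fun Q => motifCoreMonolithic θ ε R r η L δ L' s ϱ' Q + motifCoreWalled θ ε R r η L δ L' s ϱ' Q)
      (fun Q => motifCoreIncoherent_eq_monolithic_add_walled θ ε R r η L δ L' s ϱ' Q),
    speciesPricing_add_iff]
  exact Iff.rfl

/-- ★ **EXACT**: `BALL ⟺ BALL|monolithic ∧ BALL|walled`, every parameter (part I-B's ∀-split along the cut). -/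
theorem coreBallPricing_iff_monolithic_walled :
    CoreBallPricing θ ε R r η L δ L' ϱ c₁ ↔
      CoreBallPricingOn θ ε R r η L δ L' ϱ c₁ (fun Q x => IsMonolithicAt θ L' s ϱ' Q x) ∧
        CoreBallPricingOn θ ε R r η L δ L' ϱ c₁ (fun Q x => ¬ IsMonolithicAt θ L' s ϱ' Q x) :=
  coreBallPricing_iff_on_and_on_not _

variable {θ ε R r η L δ L' s ϱ' ϱ c₁}

/-- Dial end `s ≥ 2L'`: no walled core … -/
theorem motifCoreWalled_eq_zero_of_two_mul_le (hs : 2 * L' ≤ s) (Q : PeriodicConfiguration 3) :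
    motifCoreWalled θ ε R r η L δ L' s ϱ' Q = 0 := by
  haveI : IsEmpty {x : Q.motif // IsCore θ ε R r η L δ L' Q x ∧ ¬ IsMonolithicAt θ L' s ϱ' Q x} :=
    ⟨fun x => x.2.2 (monolithic_of_two_mul_le hs Q _)⟩
  exact Nat.card_of_isEmpty

/-- … so BALL|walled and WCP hold trivially there, and BALL|monolithic is all of BALL. -/
theorem coreBallPricingOn_walled_of_two_mul_le (hs : 2 * L' ≤ s) :
    CoreBallPricingOn θ ε R r η L δ L' ϱ c₁ (fun Q x => ¬ IsMonolithicAt θ L' s ϱ' Q x) :=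
  ⟨c₁ + 1, 0, lt_add_one c₁, le_rfl, fun Q x _ hw => (hw (monolithic_of_two_mul_le hs Q (x : E3))).elim⟩

/-- Dial end `2L' ≤ s`: the walled species is empty, so walled core pricing holds trivially. -/
theorem walledCorePricing_of_two_mul_le (hs : 2 * L' ≤ s) : WalledCorePricing θ ε R r η L δ L' s ϱ' :=
  ⟨1, one_pos, fun Q => by
    rw [motifCoreWalled_eq_zero_of_two_mul_le hs, Nat.cast_zero, mul_zero]; exact excess_nonneg' Q⟩

/-- Dial end `2L' ≤ s`: every core is monolithic, so BALL|mono is BALL. -/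
theorem coreBallPricingOn_monolithic_iff_of_two_mul_le (hs : 2 * L' ≤ s) :
    CoreBallPricingOn θ ε R r η L δ L' ϱ c₁ (fun Q x => IsMonolithicAt θ L' s ϱ' Q x) ↔
      CoreBallPricing θ ε R r η L δ L' ϱ c₁ := by
  rw [coreBallPricing_iff_monolithic_walled θ ε R r η L δ L' s ϱ' ϱ c₁]
  exact ⟨fun h => ⟨h, coreBallPricingOn_walled_of_two_mul_le hs⟩, fun h => h.1⟩

/-- Dial end `s < 0`: no monolithic core (every incoherent core has crystal within `L'`) … -/
theorem motifCoreMonolithic_eq_zero_of_neg (hs : s < 0) (Q : PeriodicConfiguration 3) :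
    motifCoreMonolithic θ ε R r η L δ L' s ϱ' Q = 0 := by
  haveI : IsEmpty {x : Q.motif // IsCore θ ε R r η L δ L' Q x ∧ IsMonolithicAt θ L' s ϱ' Q x} :=
    ⟨fun x => not_monolithic_of_neg_of_not_coherentWithin hs x.2.1.not_coherentWithin x.2.2⟩
  exact Nat.card_of_isEmpty

/-- … so BALL|monolithic and MCP hold trivially there, and BALL|walled is all of BALL. -/
theorem coreBallPricingOn_monolithic_of_neg (hs : s < 0) :
    CoreBallPricingOn θ ε R r η L δ L' ϱ c₁ (fun Q x => IsMonolithicAt θ L' s ϱ' Q x) :=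
  ⟨c₁ + 1, 0, lt_add_one c₁, le_rfl, fun _ _ hx hm =>
    (not_monolithic_of_neg_of_not_coherentWithin hs hx.not_coherentWithin hm).elim⟩

/-- Dial end `s < 0`: the monolithic species is empty, so monolithic core pricing holds trivially. -/
theorem monolithicCorePricing_of_neg (hs : s < 0) : MonolithicCorePricing θ ε R r η L δ L' s ϱ' :=
  ⟨1, one_pos, fun Q => by
    rw [motifCoreMonolithic_eq_zero_of_neg hs, Nat.cast_zero, mul_zero]; exact excess_nonneg' Q⟩

/-- Dial end `s < 0`: every core is walled, so BALL|walled is BALL. -/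
theorem coreBallPricingOn_walled_iff_of_neg (hs : s < 0) :
    CoreBallPricingOn θ ε R r η L δ L' ϱ c₁ (fun Q x => ¬ IsMonolithicAt θ L' s ϱ' Q x) ↔
      CoreBallPricing θ ε R r η L δ L' ϱ c₁ := by
  rw [coreBallPricing_iff_monolithic_walled θ ε R r η L δ L' s ϱ' ϱ c₁]
  exact ⟨fun h => ⟨coreBallPricingOn_monolithic_of_neg hs, h⟩, fun h => h.2⟩

/-! ### The record `(s, ϱ') = (6/5, 80)` beneath the record BALL `(ϱ, c₁) = (160, 1/20)` -/

/-- ★ RECORD: the engine target's localisation, cut by transmission — `ChargedEnergyGap` from IP · FCP(40) · CCP · BALL|monolithic ·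
BALL|walled · FAR · the P-side piece (seven leaves, by name). -/
theorem chargedEnergyGap_of_transmissionCut_record
    (hIP : ImprovablePricing (3 / 20) (1 / 10) (6 / 5) 10 (1 / 100))
    (hFCP : FrustratedCorePricing (3 / 20) (1 / 10) (6 / 5) 10 (1 / 100) 40)
    (hCCP : CoherentCorePricing (3 / 20) (1 / 10) (6 / 5) 10 (1 / 100) 40 (1 / 10) 40)
    (hBM : CoreBallPricingOn (3 / 20) (1 / 10) (6 / 5) 10 (1 / 100) 40 (1 / 10) 40 160 (1 / 20)
      (fun Q x => IsMonolithicAt (3 / 20) 40 (6 / 5) 80 Q x))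
    (hBW : CoreBallPricingOn (3 / 20) (1 / 10) (6 / 5) 10 (1 / 100) 40 (1 / 10) 40 160 (1 / 20)
      (fun Q x => ¬ IsMonolithicAt (3 / 20) 40 (6 / 5) 80 Q x))
    (hF : FarFloor (3 / 20) (1 / 10) (6 / 5) 10 (1 / 100) 40 (1 / 10) 40 160 (1 / 20))
    (hP : ChartedChargePricing (3 / 20)) : ChargedEnergyGap :=
  chargedEnergyGap_of_ballLedger_record hIP hFCP hCCP
    ((coreBallPricing_iff_monolithic_walled (3 / 20) (1 / 10) (6 / 5) 10 (1 / 100) 40 (1 / 10) 40 (6 / 5) 80 160 (1 / 20)).2 ⟨hBM, hBW⟩)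
    hF hP

end Cut

end Summit.AtomisticToContinuum.Crystallization.Theorems.ChargedEnergyGapChartDial

end
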